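import Summits.QuantumFields.BalabanUV.Beta.GAN24.WoodburyFibreZeroModeGainTwoRate
import Summits.QuantumFields.BalabanUV.Beta.GAN24.WoodburyFibreZeroModeDec

/-!
# GAN24 / WoodburyFibreZeroModeOscComp — CALCULUS OF FORWARD-DIFFERENCE BOUNDS: the hypothesis shape of the zero-mode gain
# (`|K(p + e_μ, q) − K(p, q)| ≤ ε·e^{−δ|p−q|₁}`) is inherited by COMPOSITIONS from the extreme factor (row smoothness from the left factor,
# column smoothness from the right factor; two rates), by sums and by scalar multiples — so the smoothness of a composite leg is read off its
# outermost kernel (census row V14 of `HOME/b2b-balaban-gan24-p3/WOODBURY-FIBRE.md` v8.1; binder row G-an2-4 ∕ (CONV-C), P3, gen 8)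

Cell `pub-balaban`, β sub-cell.  HONEST FRAMING (verbatim): discharging `BetaPertH` makes Bałaban's UV stability UNCONDITIONAL — a real
constructive-QFT result; it is NOT the continuum limit and NOT the Clay problem.  HONEST DEPENDENCY (verbatim): continuum YM on T⁴ ⇐
BetaPertH ∧ nine spine estimates (0/9 proved); BetaPertH ⇐ (D1) ∧ (D4) ∧ CAP+tail; G-an2-4 gates asym, D1 and NE2/3/4.  NOT IN PRINT; OUR
BOOKKEEPING.  [folklore] over an2's `ExpKernelCalculus` ∕ `KernelWard.comp_sub_left/right` and an5's `TameKernelCalculus` BY NAME; cites nothing,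
mints no `def … : Prop`, instantiates no wall binder.  Discharges NOTHING of (CONV-C), the W-slot, «T2Shape», (D1); NEVER «G-an2-4 closed»; NOT
BetaPertH, NOT continuum, NOT Clay.

## Contents (all [folklore]; `D = d+1`, fibre `Fib d`; `axisDiffRow 1 μ K p q = K (p + e_μ) q − K p q`, `axisDiffCol` likewise — `WoodburyFibreZeroModeDec`)
* `axisDiffRow_one_apply` ∕ `axisDiffCol_one_apply`; **`axisDiffRow_comp`**: `axisDiffRow M μ (comp A B) = comp (axisDiffRow M μ A) B` (tame factors), **`axisDiffCol_comp`**: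
  `axisDiffCol M μ (comp A B) = comp A (axisDiffCol M μ B)`;
* **`fwdDiff_comp_row`**: `|A(p+e_μ,q) − A(p,q)| ≤ ε_A·e^{−δ_A|p−q|₁}` (all μ p q), `Decays A C_A δ_A` (`δ_A > 0`), `Decays B C_B δ_B` (`δ_B > 0`), `0 ≤ δ′`, `δ′ ≤ δ_B`, `δ′ < δ_A`
  ⇒ `|(A∘B)(p+e_μ,q) − (A∘B)(p,q)| ≤ (|F|·(ε_A·C_B)·Zl(δ_A − δ′))·e^{−δ′|p−q|₁}` (and the `δ′ ≤ δ_A`, `δ′ < δ_B` variant `fwdDiff_comp_row'`);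
  **`fwdDiff_comp_col`** ∕ `fwdDiff_comp_col'` (column smoothness from the right factor);
* `fwdDiff_add_row`, `fwdDiff_smul_row` (sums and scalar multiples), and the column twins.
-/

noncomputable section

open Finset
open scoped BigOperators
open Literature.MathematicalPhysics.QuantumFieldTheory
open Literature.MathematicalPhysics.QuantumFieldTheory.Balaban1983to89
open Literature.MathematicalPhysics.QuantumFieldTheory.Balaban1983to89.Beta
open B12Sec2to5 (l1 l1_nonneg)
open ExpKernelCalculus (MKer Decays comp Zl)
open KernelWard (comp_sub_right comp_sub_left)
open Summit.QuantumFields.BalabanUV.Beta.TameKernelCalculus (Tame Spr slices_tame)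
open AffineAveraging (unitVec)
open OneStepResolventKernel (Fib)
open Summit.QuantumFields.BalabanUV.Beta.GAN24.WoodburyFibreZeroModeDec (axisDiffRow axisDiffCol decays_axisDiffRow decays_axisDiffCol)
open Summit.QuantumFields.BalabanUV.Beta.GAN24.WoodburyFibreZeroModeGainTwoRate (decays_comp_two_rate decays_comp_two_rate')

namespace Summit.QuantumFields.BalabanUV.Beta.GAN24.WoodburyFibreZeroModeOscComp

variable {d : ℕ}

/-! ## §1 The difference kernels commute with composition -/

/-- `axisDiffRow 1 μ K p q = K (p + e_μ) q − K p q`. [folklore] -/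
theorem axisDiffRow_one_apply (μ : Fin (d + 1)) (K : MKer (d + 1) (Fib d)) (p q : Fin (d + 1) → ℤ) (a b : Fib d) :
    axisDiffRow 1 μ K p q a b = K (p + unitVec μ) q a b - K p q a b := by
  simp [axisDiffRow]

/-- `axisDiffCol 1 μ K p q = K p (q + e_μ) − K p q`. [folklore] -/
theorem axisDiffCol_one_apply (μ : Fin (d + 1)) (K : MKer (d + 1) (Fib d)) (p q : Fin (d + 1) → ℤ) (a b : Fib d) :
    axisDiffCol 1 μ K p q a b = K p (q + unitVec μ) a b - K p q a b := by
  simp [axisDiffCol]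

/-- A shifted tame kernel is tame in the sense needed here: its slices against a tame `B` are summable. [folklore] -/
theorem slices_shift_tame {A B : MKer (d + 1) (Fib d)} (hA : Tame A) (hB : Tame B) (v : Fin (d + 1) → ℤ)
    (x z : Fin (d + 1) → ℤ) (a b : Fib d) : Summable fun y : Fin (d + 1) → ℤ => ∑ f, A (x + v) y a f * B y z f b :=
  slices_tame hA hB (x + v) z a b

/-- **ROW DIFFERENCES PASS TO THE LEFT FACTOR**: `axisDiffRow M μ (A ∘ B) = (axisDiffRow M μ A) ∘ B` for tame factors. [folklore] -/
theorem axisDiffRow_comp (M : ℕ) (μ : Fin (d + 1)) {A B : MKer (d + 1) (Fib d)} (hA : Tame A) (hB : Tame B) :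
    axisDiffRow M μ (comp A B) = comp (axisDiffRow M μ A) B := by
  have e : axisDiffRow M μ A = (fun p q a b => A (p + (M : ℤ) • unitVec μ) q a b) - A := by
    funext p q a b; simp [axisDiffRow]
  rw [e, comp_sub_left (fun x z a b => slices_shift_tame hA hB _ x z a b) (fun x z a b => slices_tame hA hB x z a b)]
  funext p q a b
  simp [axisDiffRow, ExpKernelCalculus.comp]

/-- **COLUMN DIFFERENCES PASS TO THE RIGHT FACTOR**: `axisDiffCol M μ (A ∘ B) = A ∘ (axisDiffCol M μ B)` for tame factors. [folklore] -/
theorem axisDiffCol_comp (M : ℕ) (μ : Fin (d + 1)) {A B : MKer (d + 1) (Fib d)} (hA : Tame A) (hB : Tame B) :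
    axisDiffCol M μ (comp A B) = comp A (axisDiffCol M μ B) := by
  have e : axisDiffCol M μ B = (fun p q a b => B p (q + (M : ℤ) • unitVec μ) a b) - B := by
    funext p q a b; simp [axisDiffCol]
  have hs : ∀ x z a b, Summable fun y : Fin (d + 1) → ℤ => ∑ f, A x y a f * (fun p q a b => B p (q + (M : ℤ) • unitVec μ) a b) y z f b :=
    fun x z a b => slices_tame hA hB x (z + (M : ℤ) • unitVec μ) a b
  rw [e, comp_sub_right hs (fun x z a b => slices_tame hA hB x z a b)]
  funext p q a b
  simp [axisDiffCol, ExpKernelCalculus.comp]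

/-! ## §2 Forward-difference bounds of compositions (two rates) -/

section Comp

variable {A B : MKer (d + 1) (Fib d)} {CA CB εA εB δA δB δ' : ℝ}

/-- The unit-step row difference kernel carries the forward-difference bound verbatim. [folklore] -/
theorem decays_axisDiffRow_one (hD : ∀ μ p q a b, |A (p + unitVec μ) q a b - A p q a b| ≤ εA * Real.exp (-δA * l1 (p - q)))
    (μ : Fin (d + 1)) : Decays (axisDiffRow 1 μ A) εA δA := by
  intro p q a b
  rw [axisDiffRow_one_apply]
  exact hD μ p q a b

/-- The unit-step column difference kernel carries the forward-difference bound verbatim. [folklore] -/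
theorem decays_axisDiffCol_one (hD : ∀ μ p q a b, |B p (q + unitVec μ) a b - B p q a b| ≤ εB * Real.exp (-δB * l1 (p - q)))
    (μ : Fin (d + 1)) : Decays (axisDiffCol 1 μ B) εB δB := by
  intro p q a b
  rw [axisDiffCol_one_apply]
  exact hD μ p q a b

/-- **ROW SMOOTHNESS OF `A ∘ B` FROM THE LEFT FACTOR** (`δ′ ≤ δ_B`, `δ′ < δ_A`; e.g. `A` the fast-and-smooth factor):
`|(A∘B)(p + e_μ, q) − (A∘B)(p, q)| ≤ (|F|·(ε_A·C_B)·Zl(δ_A − δ′))·e^{−δ′|p−q|₁}`. [folklore] -/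
theorem fwdDiff_comp_row (hA : Decays A CA δA) (hδA : 0 < δA) (hB : Decays B CB δB) (hδB : 0 < δB)
    (hD : ∀ μ p q a b, |A (p + unitVec μ) q a b - A p q a b| ≤ εA * Real.exp (-δA * l1 (p - q)))
    (h0 : 0 ≤ δ') (h1 : δ' ≤ δB) (h2 : δ' < δA) (μ : Fin (d + 1)) (p q : Fin (d + 1) → ℤ) (a b : Fib d) :
    |comp A B (p + unitVec μ) q a b - comp A B p q a b|
      ≤ ((Fintype.card (Fib d) : ℝ) * (εA * CB) * Zl (d + 1) (δA - δ')) * Real.exp (-δ' * l1 (p - q)) := by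
  have hAt : Tame A := (show Spr A from ⟨CA, δA, hδA, hA⟩).tame
  have hBt : Tame B := (show Spr B from ⟨CB, δB, hδB, hB⟩).tame
  rw [← axisDiffRow_one_apply μ (comp A B), axisDiffRow_comp 1 μ hAt hBt]
  exact decays_comp_two_rate (decays_axisDiffRow_one hD μ) hB h0 h1 h2 p q a b

/-- The same with the rates the other way round (`δ′ ≤ δ_A`, `δ′ < δ_B`; e.g. `A` the slow-and-smooth factor, `B` fast): constant `Zl(δ_B − δ′)`. [folklore] -/
theorem fwdDiff_comp_row' (hA : Decays A CA δA) (hδA : 0 < δA) (hB : Decays B CB δB) (hδB : 0 < δB)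
    (hD : ∀ μ p q a b, |A (p + unitVec μ) q a b - A p q a b| ≤ εA * Real.exp (-δA * l1 (p - q)))
    (h0 : 0 ≤ δ') (h1 : δ' ≤ δA) (h2 : δ' < δB) (μ : Fin (d + 1)) (p q : Fin (d + 1) → ℤ) (a b : Fib d) :
    |comp A B (p + unitVec μ) q a b - comp A B p q a b|
      ≤ ((Fintype.card (Fib d) : ℝ) * (εA * CB) * Zl (d + 1) (δB - δ')) * Real.exp (-δ' * l1 (p - q)) := by
  have hAt : Tame A := (show Spr A from ⟨CA, δA, hδA, hA⟩).tame
  have hBt : Tame B := (show Spr B from ⟨CB, δB, hδB, hB⟩).tame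
  rw [← axisDiffRow_one_apply μ (comp A B), axisDiffRow_comp 1 μ hAt hBt]
  exact decays_comp_two_rate' (decays_axisDiffRow_one hD μ) hB h0 h1 h2 p q a b

/-- **COLUMN SMOOTHNESS OF `A ∘ B` FROM THE RIGHT FACTOR** (`δ′ ≤ δ_A`, `δ′ < δ_B`):
`|(A∘B)(p, q + e_μ) − (A∘B)(p, q)| ≤ (|F|·(C_A·ε_B)·Zl(δ_B − δ′))·e^{−δ′|p−q|₁}`. [folklore] -/
theorem fwdDiff_comp_col (hA : Decays A CA δA) (hδA : 0 < δA) (hB : Decays B CB δB) (hδB : 0 < δB)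
    (hD : ∀ μ p q a b, |B p (q + unitVec μ) a b - B p q a b| ≤ εB * Real.exp (-δB * l1 (p - q)))
    (h0 : 0 ≤ δ') (h1 : δ' ≤ δA) (h2 : δ' < δB) (μ : Fin (d + 1)) (p q : Fin (d + 1) → ℤ) (a b : Fib d) :
    |comp A B p (q + unitVec μ) a b - comp A B p q a b|
      ≤ ((Fintype.card (Fib d) : ℝ) * (CA * εB) * Zl (d + 1) (δB - δ')) * Real.exp (-δ' * l1 (p - q)) := by
  have hAt : Tame A := (show Spr A from ⟨CA, δA, hδA, hA⟩).tame
  have hBt : Tame B := (show Spr B from ⟨CB, δB, hδB, hB⟩).tame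
  rw [← axisDiffCol_one_apply μ (comp A B), axisDiffCol_comp 1 μ hAt hBt]
  exact decays_comp_two_rate' hA (decays_axisDiffCol_one hD μ) h0 h1 h2 p q a b

/-- The same with the rates the other way round (`δ′ ≤ δ_B`, `δ′ < δ_A`): constant `Zl(δ_A − δ′)`. [folklore] -/
theorem fwdDiff_comp_col' (hA : Decays A CA δA) (hδA : 0 < δA) (hB : Decays B CB δB) (hδB : 0 < δB)
    (hD : ∀ μ p q a b, |B p (q + unitVec μ) a b - B p q a b| ≤ εB * Real.exp (-δB * l1 (p - q)))
    (h0 : 0 ≤ δ') (h1 : δ' ≤ δB) (h2 : δ' < δA) (μ : Fin (d + 1)) (p q : Fin (d + 1) → ℤ) (a b : Fib d) :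
    |comp A B p (q + unitVec μ) a b - comp A B p q a b|
      ≤ ((Fintype.card (Fib d) : ℝ) * (CA * εB) * Zl (d + 1) (δA - δ')) * Real.exp (-δ' * l1 (p - q)) := by
  have hAt : Tame A := (show Spr A from ⟨CA, δA, hδA, hA⟩).tame
  have hBt : Tame B := (show Spr B from ⟨CB, δB, hδB, hB⟩).tame
  rw [← axisDiffCol_one_apply μ (comp A B), axisDiffCol_comp 1 μ hAt hBt]
  exact decays_comp_two_rate hA (decays_axisDiffCol_one hD μ) h0 h1 h2 p q a b

end Comp

/-! ## §3 Sums and scalar multiples -/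

section Linear

variable {A A' : MKer (d + 1) (Fib d)} {ε ε' δ : ℝ}

/-- Row smoothness is additive. [folklore] -/
theorem fwdDiff_add_row (hD : ∀ μ p q a b, |A (p + unitVec μ) q a b - A p q a b| ≤ ε * Real.exp (-δ * l1 (p - q)))
    (hD' : ∀ μ p q a b, |A' (p + unitVec μ) q a b - A' p q a b| ≤ ε' * Real.exp (-δ * l1 (p - q)))
    (μ : Fin (d + 1)) (p q : Fin (d + 1) → ℤ) (a b : Fib d) :
    |(A + A') (p + unitVec μ) q a b - (A + A') p q a b| ≤ (ε + ε') * Real.exp (-δ * l1 (p - q)) := by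
  have h1 := hD μ p q a b
  have h2 := hD' μ p q a b
  calc |(A + A') (p + unitVec μ) q a b - (A + A') p q a b|
      = |(A (p + unitVec μ) q a b - A p q a b) + (A' (p + unitVec μ) q a b - A' p q a b)| := by
        simp only [Pi.add_apply]; ring_nf
    _ ≤ |A (p + unitVec μ) q a b - A p q a b| + |A' (p + unitVec μ) q a b - A' p q a b| := abs_add_le _ _
    _ ≤ ε * Real.exp (-δ * l1 (p - q)) + ε' * Real.exp (-δ * l1 (p - q)) := add_le_add h1 h2
    _ = (ε + ε') * Real.exp (-δ * l1 (p - q)) := by ring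

/-- Column smoothness is additive. [folklore] -/
theorem fwdDiff_add_col (hD : ∀ μ p q a b, |A p (q + unitVec μ) a b - A p q a b| ≤ ε * Real.exp (-δ * l1 (p - q)))
    (hD' : ∀ μ p q a b, |A' p (q + unitVec μ) a b - A' p q a b| ≤ ε' * Real.exp (-δ * l1 (p - q)))
    (μ : Fin (d + 1)) (p q : Fin (d + 1) → ℤ) (a b : Fib d) :
    |(A + A') p (q + unitVec μ) a b - (A + A') p q a b| ≤ (ε + ε') * Real.exp (-δ * l1 (p - q)) := by
  have h1 := hD μ p q a b
  have h2 := hD' μ p q a b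
  calc |(A + A') p (q + unitVec μ) a b - (A + A') p q a b|
      = |(A p (q + unitVec μ) a b - A p q a b) + (A' p (q + unitVec μ) a b - A' p q a b)| := by
        simp only [Pi.add_apply]; ring_nf
    _ ≤ |A p (q + unitVec μ) a b - A p q a b| + |A' p (q + unitVec μ) a b - A' p q a b| := abs_add_le _ _
    _ ≤ ε * Real.exp (-δ * l1 (p - q)) + ε' * Real.exp (-δ * l1 (p - q)) := add_le_add h1 h2
    _ = (ε + ε') * Real.exp (-δ * l1 (p - q)) := by ring

/-- Row smoothness under scalar multiples. [folklore] -/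
theorem fwdDiff_smul_row (c : ℝ) (hD : ∀ μ p q a b, |A (p + unitVec μ) q a b - A p q a b| ≤ ε * Real.exp (-δ * l1 (p - q)))
    (μ : Fin (d + 1)) (p q : Fin (d + 1) → ℤ) (a b : Fib d) :
    |(c • A) (p + unitVec μ) q a b - (c • A) p q a b| ≤ (|c| * ε) * Real.exp (-δ * l1 (p - q)) := by
  have h1 := hD μ p q a b
  calc |(c • A) (p + unitVec μ) q a b - (c • A) p q a b| = |c| * |A (p + unitVec μ) q a b - A p q a b| := by
        simp only [Pi.smul_apply, smul_eq_mul]; rw [← mul_sub, abs_mul]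
    _ ≤ |c| * (ε * Real.exp (-δ * l1 (p - q))) := mul_le_mul_of_nonneg_left h1 (abs_nonneg c)
    _ = (|c| * ε) * Real.exp (-δ * l1 (p - q)) := by ring

/-- Column smoothness under scalar multiples. [folklore] -/
theorem fwdDiff_smul_col (c : ℝ) (hD : ∀ μ p q a b, |A p (q + unitVec μ) a b - A p q a b| ≤ ε * Real.exp (-δ * l1 (p - q)))
    (μ : Fin (d + 1)) (p q : Fin (d + 1) → ℤ) (a b : Fib d) :
    |(c • A) p (q + unitVec μ) a b - (c • A) p q a b| ≤ (|c| * ε) * Real.exp (-δ * l1 (p - q)) := by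
  have h1 := hD μ p q a b
  calc |(c • A) p (q + unitVec μ) a b - (c • A) p q a b| = |c| * |A p (q + unitVec μ) a b - A p q a b| := by
        simp only [Pi.smul_apply, smul_eq_mul]; rw [← mul_sub, abs_mul]
    _ ≤ |c| * (ε * Real.exp (-δ * l1 (p - q))) := mul_le_mul_of_nonneg_left h1 (abs_nonneg c)
    _ = (|c| * ε) * Real.exp (-δ * l1 (p - q)) := by ring

end Linear

end Summit.QuantumFields.BalabanUV.Beta.GAN24.WoodburyFibreZeroModeOscComp

end
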